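import Mathlib
import Summits.NavierStokesRegularity.NavierStokesRegularity.Theorems.OrthantWakeForwardSourceSmoothing
import Summits.NavierStokesRegularity.NavierStokesRegularity.Theorems.OrthantWakeOrthantInvariance
import Summits.NavierStokesRegularity.NavierStokesRegularity.Theorems.WakeRatchetAdmissibleEternalBoundOrthantBound
import HarnessLib

/-!
# `OrthantWake.DyadicBreakBelowOne` — the SOCKET: a `ν`-uniform weighted a-priori bound with any
# exponent `w > 1/2` on the one-mode chain forbids Theorem 4.2-level blow-up at EVERY ratio

Item stmt-NavierStokesRegularity-24644 (`OrthantWake.DyadicBreakBelowOne`, aside «open in print»: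
`∀ ε₀ ∈ (0,1), ∀ X₀, ¬ NoGlobalCascade ε₀ dyadicTable X₀`, i.e. Barbato–Morandin–Romito's
Theorem 1 for the Katz–Pavlović chain at shell ratio `1+ε₀ < 2`).  This file lands the
RATIO-INDEPENDENT half of that item once and for all, as a «socket» into which any a-priori
estimate can be plugged:

* `not_noGlobalCascade_dyadicTable_of_weightBound` — for EVERY `ε₀ > 0` and every datum `X₀`: if
  for each viscosity `ν > 0` there are an exponent `w > 1/2` and a constant `C` such that every
  regular `ν`-viscous solution `X` of the lattice of `dyadicTable` from the one-shell datum `X₀` on a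
  window `[0,s]` (Tao's (4.5) weight bound, continuity, the exact motion within `[0,s]`, and — given
  for free — non-negativity on the shells `k ≥ 1`) obeys `(1+ε₀)^{wn} |X_{0,n}(t)| ≤ C` for all
  shells `n ≥ 0` and `t ∈ [0,s]`, then `¬ NoGlobalCascade ε₀ dyadicTable X₀`.

So the open content of the item at ratio `b = 1+ε₀` is EXACTLY a `ν`-uniform weighted supremum
bound with some exponent `w ∈ (1/2, 5/6)` (BMR's Lemma 2.1 gives `w = 1/2 + 1/100` at `b = 2`; the
inviscid Kolmogorov front has `5/6`), and nothing else.

PROOF.  `η := 2w − 1 > 0`.  The weighted bound gives `½X_{0,k}(t)² ≤ ½C²(1+ε₀)^{−2wk}`, whose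
partial tail sums over `k ∈ [n,N]` are `≤ ½C²/(1 − (1+ε₀)^{−2w}) · (1+ε₀)^{−(1+η)n}`
(`dyadicSocket_envelope`, a geometric sum) — this is the hypothesis of the landed crux
`OrthantWake.ForwardSourceSmoothing` (stmt-26374, `forwardSourceSmoothing_proof`) for the table
`dyadicTable ∈ E₂(2)` (`inTableClass_dyadicTable`) with the single forward source `S = {0}`
(`dyadicSocket_source`); the positivity input of the weighted bound is the landed
`orthantInvariance_proof` (stmt-24642) fed with the Kamke condition of the dyadic member
(`WakeRatchetOrthant.quasiPositive_dyadicTable`).  Hence a global regular `ν`-viscous solution exists for every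
`ν > 0`, i.e. `HasGlobal ε₀ dyadicTable κ κ 0 X₀` for every `κ > 0` (`hasGlobal_of_viscousGlobal`
with `ν = κ/√2`, `hasGlobal_mono`), which is `¬ NoGlobalCascade` by the normal form
`noGlobalCascade_iff_kappa`.

HONEST FRAMING: statements about a MODEL lattice ODE (route OrthantWake, rung TL-M2Break); this
file proves no weighted bound — it only isolates it as the one missing estimate; nothing here is a
statement about the Navier–Stokes equations, and no crux or summit is proved.
-/

noncomputable section

set_option linter.dupNamespace false

namespace Summit.NavierStokesRegularity.NavierStokesRegularity.Theorems

open Set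
open Literature.Analysis.FluidPDE.TaoCascade

/-- The Kamke (quasi-positivity) condition of the dyadic member in the shape used by the route's
`OrthantInvariance`: on a configuration that is non-negative on the shells `≥ 1`, a vanishing
mode `(i,n)`, `n ≥ 1`, is driven upwards (`WakeRatchetOrthant.quasiPositive_dyadicTable`, which needs neither the sign
hypothesis nor `n ≥ 1`). MODEL lattice statement. [this file] -/
theorem dyadicSocket_kamke :
    ∀ (Y : Fin 4 → ℤ → ℝ → ℝ) (τ : ℝ), (∀ (j : Fin 4) (k : ℤ), 1 ≤ k → 0 ≤ Y j k τ) →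
      ∀ δ : ℝ, 0 < δ → ∀ (i : Fin 4) (n : ℤ), 1 ≤ n → Y i n τ = 0 →
        0 ≤ quadTerm δ dyadicTable Y i n τ :=
  fun Y τ _ δ hδ i n _ hY => WakeRatchetOrthant.quasiPositive_dyadicTable Y τ δ hδ i n hY

/-- The dyadic member has the single forward source `0`: off `S = {0}` every `(0,0,1)`-coefficient
vanishes. MODEL lattice statement. [this file] -/
theorem dyadicSocket_source :
    ∀ i : Fin 4, i ∉ ({0} : Finset (Fin 4)) → ∀ j l : Fin 4, dyadicTable i j l (0, 0, 1) = 0 := by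
  intro i hi j l
  have h : ¬ (i = 0 ∧ j = 0 ∧ l = 0) := fun h => hi (by simp [h.1])
  exact dyadicTable_of_not h

/-- Geometric partial tail: `Σ_{k=n}^{N} r^k ≤ rⁿ/(1−r)` for `0 ≤ r < 1`. [folklore] -/
theorem dyadicSocket_geom {r : ℝ} (hr0 : 0 ≤ r) (hr1 : r < 1) (n N : ℕ) :
    ∑ k ∈ Finset.Icc n N, r ^ k ≤ r ^ n / (1 - r) := by
  rw [← Finset.Ico_add_one_right_eq_Icc]
  exact geom_sum_Ico_le_of_lt_one hr0 hr1

/-- **Weighted supremum bound ⇒ forward-source envelope.** If `(1+ε₀)^{wk}|X_{0,k}(t)| ≤ C` for all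
shells `k ≥ 0` at the time `t`, then the `{0}`-mode partial tail energies obey
`Σ_{k=n}^{N} ½X_{0,k}(t)² ≤ ½C²/(1 − (1+ε₀)^{−2w}) · (1+ε₀)^{−(1+(2w−1))n}` — the hypothesis of
`OrthantWake.ForwardSourceSmoothing` with `η = 2w − 1`. MODEL lattice statement. [this file] -/
theorem dyadicSocket_envelope {ε₀ w C t : ℝ} (hε₀ : 0 < ε₀) (hw : 0 < w)
    {X : Fin 4 → ℤ → ℝ → ℝ}
    (hb : ∀ k : ℕ, (1 + ε₀) ^ (w * k) * |X 0 k t| ≤ C) (n N : ℕ) :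
    ∑ k ∈ Finset.Icc n N, ∑ i ∈ ({0} : Finset (Fin 4)), (1 / 2 : ℝ) * X i (k : ℤ) t ^ 2 ≤
      1 / 2 * C ^ 2 / (1 - (1 + ε₀) ^ (-(2 * w))) *
        (1 + ε₀) ^ (-((1 + (2 * w - 1)) * (n : ℝ))) := by
  have hb0 : (0 : ℝ) < 1 + ε₀ := by linarith
  have hb1 : (1 : ℝ) < 1 + ε₀ := by linarith
  set r : ℝ := (1 + ε₀) ^ (-(2 * w)) with hr
  have hr0 : 0 < r := Real.rpow_pos_of_pos hb0 _
  have hr1 : r < 1 := Real.rpow_lt_one_of_one_lt_of_neg hb1 (by linarith)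
  have hC : 0 ≤ C := by
    have h := hb 0
    simp only [Nat.cast_zero, mul_zero, Real.rpow_zero, one_mul] at h
    exact (abs_nonneg _).trans h
  -- each term is at most `½ C² r^k`
  have hterm : ∀ k : ℕ, ∑ i ∈ ({0} : Finset (Fin 4)), (1 / 2 : ℝ) * X i (k : ℤ) t ^ 2 ≤
      1 / 2 * C ^ 2 * r ^ k := by
    intro k
    rw [Finset.sum_singleton]
    have hwk : 0 < (1 + ε₀) ^ (w * k) := Real.rpow_pos_of_pos hb0 _
    have h1 : |X 0 k t| ≤ C * (1 + ε₀) ^ (-(w * k)) := by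
      rw [Real.rpow_neg hb0.le, ← div_eq_mul_inv, le_div_iff₀ hwk, mul_comm]
      exact hb k
    have h2 : X 0 (k : ℤ) t ^ 2 ≤ (C * (1 + ε₀) ^ (-(w * k))) ^ 2 := by
      rw [← sq_abs]
      exact pow_le_pow_left₀ (abs_nonneg _) h1 2
    have h3 : (C * (1 + ε₀) ^ (-(w * k))) ^ 2 = C ^ 2 * r ^ k := by
      rw [mul_pow, hr, ← Real.rpow_natCast ((1 + ε₀) ^ (-(2 * w))) k, ← Real.rpow_mul hb0.le,
        ← Real.rpow_natCast ((1 + ε₀) ^ (-(w * k))) 2, ← Real.rpow_mul hb0.le]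
      congr 1
      congr 1
      push_cast
      ring
    nlinarith [h2, h3]
  calc ∑ k ∈ Finset.Icc n N, ∑ i ∈ ({0} : Finset (Fin 4)), (1 / 2 : ℝ) * X i (k : ℤ) t ^ 2
      ≤ ∑ k ∈ Finset.Icc n N, 1 / 2 * C ^ 2 * r ^ k := Finset.sum_le_sum fun k _ => hterm k
    _ = 1 / 2 * C ^ 2 * ∑ k ∈ Finset.Icc n N, r ^ k := by rw [Finset.mul_sum]
    _ ≤ 1 / 2 * C ^ 2 * (r ^ n / (1 - r)) :=
        mul_le_mul_of_nonneg_left (dyadicSocket_geom hr0.le hr1 n N) (by positivity)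
    _ = 1 / 2 * C ^ 2 / (1 - r) * r ^ n := by ring
    _ = 1 / 2 * C ^ 2 / (1 - (1 + ε₀) ^ (-(2 * w))) *
          (1 + ε₀) ^ (-((1 + (2 * w - 1)) * (n : ℝ))) := by
        rw [hr, ← Real.rpow_natCast ((1 + ε₀) ^ (-(2 * w))) n, ← Real.rpow_mul hb0.le]
        congr 2
        ring

/-- **THE SOCKET.** For every ratio `1+ε₀ > 1` and every one-shell datum `X₀`: if for each viscosity
`ν > 0` some exponent `w > 1/2` and constant `C` bound `(1+ε₀)^{wn}|X_{0,n}(t)|` for every regular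
`ν`-viscous solution of the lattice of `dyadicTable` from `X₀` on every window `[0,s]` (the
solution is handed over together with its non-negativity on the shells `≥ 1`, which holds by
`orthantInvariance_proof`), then Theorem 4.2-level blow-up fails: `¬ NoGlobalCascade ε₀ dyadicTable X₀`.
Assembly: `dyadicSocket_envelope` ⇒ `forwardSourceSmoothing_proof` (`S = {0}`, `η = 2w−1`,
`dyadicTable ∈ E₂(2)`) ⇒ `ViscousGlobal` for every `ν` ⇒ `hasGlobal_of_viscousGlobal`,
`hasGlobal_mono`, `noGlobalCascade_iff_kappa`. MODEL lattice statement; no estimate is proved here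
and nothing is claimed about Navier–Stokes. [this file] -/
theorem not_noGlobalCascade_dyadicTable_of_weightBound {ε₀ : ℝ} (hε₀ : 0 < ε₀) {X₀ : Fin 4 → ℝ}
    (H : ∀ ν : ℝ, 0 < ν → ∃ w C : ℝ, 1 / 2 < w ∧ ∀ s : ℝ, 0 < s → ∀ X : Fin 4 → ℤ → ℝ → ℝ,
      (∀ i k, X i k 0 = if k = 0 then X₀ i else 0) →
      (∀ i k, k < 0 → ∀ t, X i k t = 0) →
      (∃ M : ℝ, ∀ (t : ℝ) (i : Fin 4) (k : ℤ), (1 + (1 + ε₀) ^ ((10 : ℝ) * k)) * |X i k t| ≤ M) →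
      (∀ i k, Continuous (X i k)) →
      (∀ i k, ∀ t ∈ Icc (0 : ℝ) s, HasDerivWithinAt (X i k)
        (quadTerm ε₀ dyadicTable X i k t - ν * (1 + ε₀) ^ ((2 : ℝ) * k) * X i k t) (Icc 0 s) t) →
      (∀ t ∈ Icc (0 : ℝ) s, ∀ (i : Fin 4) (k : ℤ), 1 ≤ k → 0 ≤ X i k t) →
      ∀ n : ℕ, ∀ t ∈ Icc (0 : ℝ) s, (1 + ε₀) ^ (w * n) * |X 0 n t| ≤ C) :
    ¬ NoGlobalCascade ε₀ dyadicTable X₀ := by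
  intro hNG
  obtain ⟨κ, hκ, hno⟩ := (noGlobalCascade_iff_kappa hε₀).1 hNG
  have h2 : 0 < Real.sqrt 2 := Real.sqrt_pos.2 two_pos
  have hν : 0 < κ / Real.sqrt 2 := div_pos hκ h2
  obtain ⟨w, C, hw, HC⟩ := H (κ / Real.sqrt 2) hν
  have hη : 0 < 2 * w - 1 := by linarith
  have hI := orthantInvariance_proof
  unfold Summit.NavierStokesRegularity.NavierStokesRegularity.Theses.OrthantWake.OrthantInvariance at hI
  have hB := forwardSourceSmoothing_proof
  unfold Summit.NavierStokesRegularity.NavierStokesRegularity.Theses.OrthantWake.ForwardSourceSmoothing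
    at hB
  obtain ⟨X, hX⟩ := hB ε₀ (2 * w - 1) 2 hε₀ hη dyadicTable (inTableClass_dyadicTable le_rfl)
    ({0} : Finset (Fin 4)) dyadicSocket_source X₀ (κ / Real.sqrt 2) hν
    (fun T _hT => ⟨1 / 2 * C ^ 2 / (1 - (1 + ε₀) ^ (-(2 * w))),
      fun s hs Y hinit hlow hbd hcont hder n N _hnN t ht => by
        have hnonneg := hI ε₀ (κ / Real.sqrt 2) hε₀ hν dyadicTable dyadicSocket_kamke X₀ s hs.1 Y
          hinit hlow hbd hcont hder
        have hwb := HC s hs.1 Y hinit hlow hbd hcont hder hnonneg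
        exact dyadicSocket_envelope hε₀ (by linarith) (fun k => hwb k t ht) n N⟩)
  have hG := hasGlobal_of_viscousGlobal hε₀ hν.le hX
  rw [div_mul_cancel₀ κ h2.ne'] at hG
  exact hno (hasGlobal_mono hε₀.le hG le_rfl hκ.le)

end Summit.NavierStokesRegularity.NavierStokesRegularity.Theorems

end
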